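import Summits.QuantumFields.YangMills.Theorems.F4SubCurvatureDoorShortRootRigidityHermitianTubeFunction
import Summits.QuantumFields.YangMills.Theorems.F4SubCurvatureDoorShortRootRigidityPlanarFrameTimeHolomorphy
import Summits.QuantumFields.YangMills.Theorems.F4SubCurvatureDoorAngularContinuationCharts
import Summits.QuantumFields.YangMills.Theorems.F4SubCurvatureDoorShortRootRigiditySliceInClass
import Mathlib
import HarnessLib

/-!
# Rung R2 «HERMITIAN ANGULAR CONTINUATION», UNFOLDED: three un-conjugated `D₃` charts glue to an entire `2π/3`-periodic function
# of little-o exponential type `6`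

Free-hands work of width seat `ym-line-sfw-p2-w3` (g39, cell `ym-idea-1`).  Rung **R2 `HermitianAngularRung`** of the insurance sub-line
g22-A «Hermitian slice» (`Cruxes/ShortRootRigidity/Lines/hermitian_slice_rungs.lean` fdd8f4dcefd5, owner ym-idea-3 g22, critic idea-crit-4
g10 PASS tier B) for the registered stub `:146 stub_oddModeRigidity` of crux ⟨stmt-QuantumFields-23035⟩ `F4SubCurvatureDoor.ShortRootRigidity`.

`hermitianAngular_unfolded`: let `k : ℝ² → ℂ` be invariant under the time reflection `θ₂` and the hexagonal reflection `θ_hex` (hence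
under the ROTATION by `2π/3`, `polar r (φ − 2π/3) = θ_hex(θ₂(θ_hex(θ₂(polar r φ))))` — ✓`polar_sub_pi_div_three` twice, no `−1` needed),
let `μ` represent `k` on `{t > 0}` in the complex Laplace–Fourier form `k(t, x) = ∫ e^{−tE}e^{ixp} dμ` with `e^{−tE} ∈ L¹(μ)`, let `μ` have
aperture `1` (`μ{E < |p|} = 0`), and let `‖y‖⁶‖k y‖ → 0` at `0`.  Then on every circle `‖y‖ = r > 0` the angular trace `φ ↦ k(polar r φ)`
is the restriction of an ENTIRE `2π/3`-periodic `G` with `‖G(φ + iψ)‖ ≤ δ e^{6|ψ|}` for `|ψ| ≥ Ψ(δ)` — the conclusion of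
`HermitianAngularContinuation k` character for character.

PROOF (pattern ✓`stub_angularContinuation`, `Theorems/F4SubCurvatureDoorAngularContinuation.lean`, with period `π/3 ↦ 2π/3` and the
`ε`-shifted cone charts replaced by the single tube function `F(ζ, β) = ∫ e^{−ζE}e^{iβp}dμ` of ✓`exists_hermitianTubeFunction`):
* CHARTS `G_j(θ) = F(r cos(θ − 2πj/3), r sin(θ − 2πj/3))`, `j ∈ ℤ`, holomorphic on the strip `|Re θ − 2πj/3| < π/2` — the chart point lies
  in the forward tube iff `cos(Re θ − 2πj/3) > 0` (`Re ζ − |Im β| = r cos(Re θ − 2πj/3) e^{−|Im θ|}`, ✓`chart_re_sub_abs_im`);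
* REAL VALUES `G_j(t) = k(polar r (t − 2πj/3)) = k(polar r t)` (real trace of `F` + the `D₃` rotation);
* GLUING: two charts agree on the (convex) overlap of their strips by the identity theorem from the reals (✓`eqOn_of_eq_on_real`), so
  `G(θ) := G_{round(Re θ/(2π/3))}(θ)` is entire, restricts to `k(polar r ·)` on `ℝ`, and is `2π/3`-periodic (identity theorem on `ℂ`);
* GROWTH: `‖G(θ)‖ ≤ ∫ e^{−sE}dμ = ‖k(s, 0)‖` with `s = r cos(Re θ − 2πj/3)e^{−|Im θ|} ≥ (r/2)e^{−|Im θ|}` for the nearest `j`, and the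
  budget gives `‖k(s, 0)‖ ≤ δ(r/2)⁶ s⁻⁶ ≤ δ e^{6|Im θ|}` once `s < ρ₀(δ)`.

Mathlib + tree only; no `sorry`; no definitions.  The by-name rung `hermitianAngularRung_holds : HermitianAngularRung` is the one-line
specialisation of `hermitianAngular_unfolded` (filed separately over the vocabulary file of w4 g25).

HONEST LABEL: ONE rung (M) of an unregistered INSURANCE sub-line; R1, R4, H1–H4, `:146`, ⟨23035⟩, ⟨23125⟩, R2d and the Yang–Mills
mass gap are OPEN; no summit is proved by a line.
-/

noncomputable section

namespace Summit.QuantumFields.YangMills.Theorems.F4SubCurvatureDoorHermitianAngular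

open MeasureTheory Complex Filter Set Metric Function
open scoped Topology Real
open Literature.MathematicalPhysics.QuantumLattice (timeReflection timeReflection_apply)
open Summit.QuantumFields.YangMills.Theorems.F4SubCurvatureDoorSliceDensityRegistered (E2)
open Summit.QuantumFields.YangMills.Theorems.F4SubCurvatureDoorSliceInClassRegistered (hexReflection)
open Summit.QuantumFields.YangMills.Cruxes.ShortRootRigidity.AngularType (mk2 polar fwdTube)
open Summit.QuantumFields.YangMills.Cruxes.ShortRootRigidity.AngularType.AngularChartA
  (mk2_ne_zero norm_mk2_zero polar_sub_pi_div_three chart_re_sub_abs_im chart_mem_fwdTube eqOn_of_eq_on_real)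
open Summit.QuantumFields.YangMills.Theorems.F4SubCurvatureDoorHermitianTube (exists_hermitianTubeFunction norm_trace_zero_eq)

/-! ## The `D₃` rotation by `2π/3` -/

/-- `θ_hex` is odd (it is linear). -/
theorem hexReflection_neg (y : E2) : hexReflection (-y) = -hexReflection y := by
  ext i
  fin_cases i <;> simp [hexReflection] <;> ring

/-- **The `D₃` identity** `polar r (φ − 2π/3) = θ_hex(θ₂(θ_hex(θ₂(polar r φ))))` (the hexagonal `D₆` identity
`polar r (φ − π/3) = −θ_hex(θ₂(polar r φ))` applied twice; the two signs cancel). -/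
theorem polar_sub_two_pi_div_three (r φ : ℝ) :
    polar r (φ - 2 * π / 3) = hexReflection (timeReflection 2 (hexReflection (timeReflection 2 (polar r φ)))) := by
  rw [show φ - 2 * π / 3 = (φ - π / 3) - π / 3 by ring, polar_sub_pi_div_three, polar_sub_pi_div_three, map_neg,
    hexReflection_neg, neg_neg]

variable {k : E2 → ℂ}

/-- Rotation by `−2π/3` inside the Hermitian planar class: `k(polar r (φ − 2π/3)) = k(polar r φ)`. -/
theorem polar_sub (hT : ∀ y, k (timeReflection 2 y) = k y) (hH : ∀ y, k (hexReflection y) = k y) (r φ : ℝ) :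
    k (polar r (φ - 2 * π / 3)) = k (polar r φ) := by
  rw [polar_sub_two_pi_div_three, hH, hT, hH, hT]

/-- Rotation by `+2π/3`. -/
theorem polar_add (hT : ∀ y, k (timeReflection 2 y) = k y) (hH : ∀ y, k (hexReflection y) = k y) (r φ : ℝ) :
    k (polar r (φ + 2 * π / 3)) = k (polar r φ) := by
  have h := polar_sub hT hH r (φ + 2 * π / 3)
  rw [add_sub_cancel_right] at h
  exact h.symm

/-- Rotations by all multiples of `2π/3`. -/
theorem polar_sub_int (hT : ∀ y, k (timeReflection 2 y) = k y) (hH : ∀ y, k (hexReflection y) = k y) (r φ : ℝ) (j : ℤ) :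
    k (polar r (φ - j * (2 * π / 3))) = k (polar r φ) := by
  induction j using Int.induction_on generalizing φ with
  | zero => simp
  | succ n ih =>
    have e : φ - ((n : ℤ) + 1 : ℤ) * (2 * π / 3) = (φ - (n : ℤ) * (2 * π / 3)) - 2 * π / 3 := by push_cast; ring
    rw [e, polar_sub hT hH, ih]
  | pred n ih =>
    have e : φ - (-(n : ℤ) - 1 : ℤ) * (2 * π / 3) = (φ - (-(n : ℤ) : ℤ) * (2 * π / 3)) + 2 * π / 3 := by push_cast; ring
    rw [e, polar_add hT hH, ih]

/-! ## Wide strips `|Re θ − c| < π/2` and the un-shifted chart point -/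

/-- The wide strip around the direction `c` is open. -/
theorem isOpen_wstrip (c : ℝ) : IsOpen {θ : ℂ | |θ.re - c| < π / 2} :=
  isOpen_lt (continuous_abs.comp (Complex.continuous_re.sub continuous_const)) continuous_const

/-- The wide strip is convex. -/
theorem convex_wstrip (c : ℝ) : Convex ℝ {θ : ℂ | |θ.re - c| < π / 2} := by
  have h : {θ : ℂ | |θ.re - c| < π / 2} = {θ : ℂ | c - π / 2 < θ.re} ∩ {θ : ℂ | θ.re < c + π / 2} := by
    ext θ
    simp only [mem_setOf_eq, mem_inter_iff, abs_sub_lt_iff]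
    constructor
    · rintro ⟨h1, h2⟩; constructor <;> linarith
    · rintro ⟨h1, h2⟩; constructor <;> linarith
  rw [h]
  exact (convex_halfSpace_gt Complex.reLm.isLinear _).inter (convex_halfSpace_lt Complex.reLm.isLinear _)

/-- On the wide strip, `cos(Re θ − c) > 0`. -/
theorem cos_pos_of_mem_wstrip {c : ℝ} {θ : ℂ} (hθ : |θ.re - c| < π / 2) : 0 < Real.cos (θ.re - c) := by
  rw [abs_lt] at hθ
  exact Real.cos_pos_of_mem_Ioo ⟨by linarith, by linarith⟩

/-- Membership in the wide strip only depends on the real part. -/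
theorem ofReal_re_mem_wstrip {c : ℝ} {θ : ℂ} (hθ : |θ.re - c| < π / 2) : |((θ.re : ℝ) : ℂ).re - c| < π / 2 := by
  simpa using hθ

/-- The nearest direction: `|Re θ − round(Re θ/(2π/3))·(2π/3)| ≤ π/3`. -/
theorem abs_sub_round_le (θ : ℂ) : |θ.re - (round (θ.re / (2 * π / 3)) : ℤ) * (2 * π / 3)| ≤ π / 3 := by
  have h := abs_sub_round (θ.re / (2 * π / 3))
  have hπ : 0 < 2 * π / 3 := by positivity
  have e : θ.re - (round (θ.re / (2 * π / 3)) : ℤ) * (2 * π / 3)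
      = (θ.re / (2 * π / 3) - round (θ.re / (2 * π / 3))) * (2 * π / 3) := by
    field_simp
  rw [e, abs_mul, abs_of_pos hπ]
  nlinarith [Real.pi_pos]

/-- Every `θ` lies in the wide strip of its nearest direction. -/
theorem mem_wstrip_round (θ : ℂ) : |θ.re - (round (θ.re / (2 * π / 3)) : ℤ) * (2 * π / 3)| < π / 2 :=
  (abs_sub_round_le θ).trans_lt (by linarith [Real.pi_pos])

/-- For the nearest direction, `cos(Re θ − c) ≥ 1/2`. -/
theorem half_le_cos_round (θ : ℂ) : 1 / 2 ≤ Real.cos (θ.re - (round (θ.re / (2 * π / 3)) : ℤ) * (2 * π / 3)) := by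
  rw [← Real.cos_abs, ← Real.cos_pi_div_three]
  exact Real.cos_le_cos_of_nonneg_of_le_pi (abs_nonneg _) (by linarith [Real.pi_pos]) (abs_sub_round_le θ)

/-- The un-shifted chart point `(r cos w, r sin w)` lies in the forward tube as soon as `cos(Re w) > 0` (and `r > 0`). -/
theorem chart_mem_fwdTube' {r : ℝ} (hr : 0 < r) (w : ℂ) (hc : 0 < Real.cos w.re) :
    ((r : ℂ) * Complex.cos w, (r : ℂ) * Complex.sin w) ∈ fwdTube := by
  have h := chart_mem_fwdTube (ε := 0) w (by positivity) (by positivity : (0 : ℝ) < r * Real.cos w.re * Real.exp (-|w.im|))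
  simpa using h

/-- The cone parameter of the un-shifted chart point: `Re ζ − |Im β| = r cos(Re w) e^{−|Im w|}`. -/
theorem chart_re_sub_abs_im' {r : ℝ} (w : ℂ) (hrc : 0 ≤ r * Real.cos w.re) :
    ((r : ℂ) * Complex.cos w).re - |((r : ℂ) * Complex.sin w).im| = r * Real.cos w.re * Real.exp (-|w.im|) := by
  have h := chart_re_sub_abs_im (ε := 0) w hrc
  simpa using h

/-- Real part of the shifted angle. -/
theorem re_angle (c : ℝ) (θ : ℂ) : (θ - (c : ℂ)).re = θ.re - c := by simp

/-- Imaginary part of the shifted angle. -/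
theorem im_angle (c : ℝ) (θ : ℂ) : (θ - (c : ℂ)).im = θ.im := by simp

/-! ## The rung, unfolded -/

open Summit.QuantumFields.YangMills.Theorems.F4SubCurvatureDoorPlanarFrameTimeHolomorphyRegistered renaming mk2 → mk2'

/-- **R2 «HERMITIAN ANGULAR CONTINUATION», UNFOLDED.**  For `k : ℝ² → ℂ` invariant under `θ₂` and `θ_hex`, represented on `{t > 0}` by a
complex planar Laplace–Fourier measure `μ` (`e^{−tE} ∈ L¹(μ)`, `k(t,x) = ∫ e^{−tE}e^{ixp}dμ`) of aperture `1` (`μ{E < |p|} = 0`), with the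
budget `‖y‖⁶‖k y‖ → 0` at `0`: on every circle the angular trace is the restriction of an entire `2π/3`-periodic function of little-o
exponential type `6` — the conclusion of `HermitianAngularContinuation k`, character for character. [folklore] -/
theorem hermitianAngular_unfolded (k : E2 → ℂ) (μ : Measure (ℝ × ℝ))
    (hT : ∀ y, k (timeReflection 2 y) = k y) (hH : ∀ y, k (hexReflection y) = k y)
    (hLF : ∀ t : ℝ, 0 < t → Integrable (fun z : ℝ × ℝ => Real.exp (-(t * z.1))) μ ∧
      ∀ x : ℝ, k (mk2' t x) = ∫ z, ((Real.exp (-(z.1 * t)) : ℝ) : ℂ) * Complex.exp (((z.2 * x : ℝ) : ℂ) * Complex.I) ∂μ)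
    (hap : μ {z : ℝ × ℝ | z.1 < 1 * |z.2|} = 0)
    (hbudget : Tendsto (fun y : E2 => ‖y‖ ^ 6 * ‖k y‖) (𝓝[≠] 0) (𝓝 0)) :
    ∀ r : ℝ, 0 < r → ∃ G : ℂ → ℂ, Differentiable ℂ G ∧
      (∀ φ : ℝ, G φ = k (polar r φ)) ∧
      (∀ z : ℂ, G (z + ((2 * Real.pi / 3 : ℝ) : ℂ)) = G z) ∧
      ∀ δ : ℝ, 0 < δ → ∃ Ψ : ℝ, ∀ φ ψ : ℝ, Ψ ≤ |ψ| → ‖G (φ + ψ * Complex.I)‖ ≤ δ * Real.exp (6 * |ψ|) := by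
  intro r hr
  obtain ⟨F, hFd, hFr, hFb⟩ := exists_hermitianTubeFunction μ (fun t ht => (hLF t ht).1) hap
  -- the tube function restricts to `k` at real points with positive time
  have hFk : ∀ t x : ℝ, 0 < t → F ((t : ℂ), (x : ℂ)) = k (mk2 t x) := by
    intro t x ht
    rw [hFr t x ht]
    exact ((hLF t ht).2 x).symm
  -- the chart functions
  set Gj : ℤ → ℂ → ℂ := fun j θ =>
    F ((r : ℂ) * Complex.cos (θ - (((j : ℝ) * (2 * π / 3) : ℝ) : ℂ)), (r : ℂ) * Complex.sin (θ - (((j : ℝ) * (2 * π / 3) : ℝ) : ℂ)))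
    with hGj
  -- the chart point lies in the tube on the wide strip
  have hmem : ∀ (j : ℤ) (θ : ℂ), |θ.re - j * (2 * π / 3)| < π / 2 →
      ((r : ℂ) * Complex.cos (θ - (((j : ℝ) * (2 * π / 3) : ℝ) : ℂ)), (r : ℂ) * Complex.sin (θ - (((j : ℝ) * (2 * π / 3) : ℝ) : ℂ)))
        ∈ fwdTube := by
    intro j θ hθ
    refine chart_mem_fwdTube' hr _ ?_
    rw [re_angle]
    exact cos_pos_of_mem_wstrip hθ
  -- holomorphy of `G_j` on its strip
  have hGj_diff : ∀ (j : ℤ) (θ₀ : ℂ), |θ₀.re - j * (2 * π / 3)| < π / 2 → DifferentiableAt ℂ (Gj j) θ₀ := by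
    intro j θ₀ hθ₀
    have hcomp : DifferentiableOn ℂ (Gj j) {θ : ℂ | |θ.re - j * (2 * π / 3)| < π / 2} := by
      refine hFd.comp (by fun_prop) fun θ hθ => hmem j θ hθ
    exact hcomp.differentiableAt ((isOpen_wstrip _).mem_nhds hθ₀)
  -- real values of `G_j`
  have hreal : ∀ (j : ℤ) (t : ℝ), |((t : ℂ)).re - j * (2 * π / 3)| < π / 2 → Gj j t = k (polar r t) := by
    intro j t ht
    simp only [Complex.ofReal_re] at ht
    have hc := cos_pos_of_mem_wstrip (θ := (t : ℂ)) (c := j * (2 * π / 3)) (by simpa using ht)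
    simp only [Complex.ofReal_re] at hc
    have hpos : 0 < r * Real.cos (t - j * (2 * π / 3)) := by positivity
    simp only [hGj]
    rw [show (t : ℂ) - (((j : ℝ) * (2 * π / 3) : ℝ) : ℂ) = ((t - j * (2 * π / 3) : ℝ) : ℂ) by push_cast; ring,
      ← Complex.ofReal_cos, ← Complex.ofReal_sin, ← Complex.ofReal_mul, ← Complex.ofReal_mul, hFk _ _ hpos]
    exact polar_sub_int hT hH r t j
  -- agreement across directions
  have hagree : ∀ (j j' : ℤ) (θ : ℂ), |θ.re - j * (2 * π / 3)| < π / 2 → |θ.re - j' * (2 * π / 3)| < π / 2 →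
      Gj j θ = Gj j' θ := by
    intro j j' θ hθ hθ'
    have hWopen : IsOpen ({θ : ℂ | |θ.re - j * (2 * π / 3)| < π / 2} ∩ {θ : ℂ | |θ.re - j' * (2 * π / 3)| < π / 2}) :=
      (isOpen_wstrip _).inter (isOpen_wstrip _)
    have hWconn : IsPreconnected ({θ : ℂ | |θ.re - j * (2 * π / 3)| < π / 2} ∩ {θ : ℂ | |θ.re - j' * (2 * π / 3)| < π / 2}) :=
      ((convex_wstrip _).inter (convex_wstrip _)).isPreconnected
    refine eqOn_of_eq_on_real hWopen hWconn (fun z hz => (hGj_diff j z hz.1).differentiableWithinAt)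
      (fun z hz => (hGj_diff j' z hz.2).differentiableWithinAt) (x₀ := θ.re)
      ⟨ofReal_re_mem_wstrip hθ, ofReal_re_mem_wstrip hθ'⟩ (fun t ht => ?_) ⟨hθ, hθ'⟩
    rw [hreal j t ht.1, hreal j' t ht.2]
  -- the global function
  set G : ℂ → ℂ := fun θ => Gj (round (θ.re / (2 * π / 3))) θ with hG
  have hG_eq : ∀ (j : ℤ) (θ : ℂ), |θ.re - j * (2 * π / 3)| < π / 2 → G θ = Gj j θ :=
    fun j θ hθ => hagree _ _ θ (mem_wstrip_round θ) hθ
  have hG_diff : Differentiable ℂ G := by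
    intro θ₀
    have hev : G =ᶠ[𝓝 θ₀] Gj (round (θ₀.re / (2 * π / 3))) :=
      Filter.eventuallyEq_of_mem ((isOpen_wstrip _).mem_nhds (mem_wstrip_round θ₀)) fun θ hθ => hG_eq _ θ hθ
    exact hev.differentiableAt_iff.2 (hGj_diff _ θ₀ (mem_wstrip_round θ₀))
  have hG_real : ∀ φ : ℝ, G φ = k (polar r φ) := fun φ => by
    rw [hG_eq _ _ (mem_wstrip_round (φ : ℂ))]
    exact hreal _ φ (mem_wstrip_round (φ : ℂ))
  -- periodicity
  have hG_per : ∀ z : ℂ, G (z + ((2 * Real.pi / 3 : ℝ) : ℂ)) = G z := by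
    have h := eqOn_of_eq_on_real isOpen_univ isPreconnected_univ
      ((hG_diff.comp (differentiable_id.add_const (((2 * Real.pi / 3 : ℝ) : ℂ)))).differentiableOn)
      hG_diff.differentiableOn (x₀ := 0) (mem_univ _) (fun t _ => by
        show G ((t : ℂ) + ((2 * π / 3 : ℝ) : ℂ)) = G t
        rw [show (t : ℂ) + ((2 * π / 3 : ℝ) : ℂ) = ((t + 2 * π / 3 : ℝ) : ℂ) by push_cast; ring, hG_real, hG_real]
        exact polar_add hT hH r t)
    exact fun z => h (mem_univ z)
  -- growth
  have hG_growth : ∀ δ : ℝ, 0 < δ → ∃ Ψ : ℝ, ∀ φ ψ : ℝ, Ψ ≤ |ψ| →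
      ‖G (φ + ψ * Complex.I)‖ ≤ δ * Real.exp (6 * |ψ|) := by
    intro δ hδ
    have hδ' : 0 < δ * (r / 2) ^ 6 := by positivity
    obtain ⟨ρ₀, hρ₀, hbud⟩ := Metric.tendsto_nhdsWithin_nhds.1 hbudget _ hδ'
    refine ⟨|Real.log (ρ₀ / r)| + 1, fun φ ψ hψ => ?_⟩
    set θ : ℂ := φ + ψ * Complex.I with hθdef
    have hθim : θ.im = ψ := by simp [hθdef]
    set j : ℤ := round (θ.re / (2 * π / 3)) with hjdef
    have hθS : |θ.re - j * (2 * π / 3)| < π / 2 := mem_wstrip_round θ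
    have hc : 1 / 2 ≤ Real.cos (θ.re - j * (2 * π / 3)) := half_le_cos_round θ
    rw [hG_eq j θ hθS]
    simp only [hGj]
    refine (hFb _ (hmem j θ hθS)).trans ?_
    dsimp only
    rw [chart_re_sub_abs_im' _ (by rw [re_angle]; positivity), re_angle, im_angle, hθim]
    set s : ℝ := r * Real.cos (θ.re - j * (2 * π / 3)) * Real.exp (-|ψ|) with hsdef
    have hs_pos : 0 < s := by positivity
    have hs_lower : r / 2 * Real.exp (-|ψ|) ≤ s := by nlinarith [Real.exp_pos (-|ψ|)]
    have hs_upper : s < ρ₀ := by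
      have h1 : s ≤ r * Real.exp (-|ψ|) := by
        nlinarith [Real.exp_pos (-|ψ|), Real.cos_le_one (θ.re - j * (2 * π / 3))]
      have h2 : Real.exp (-|ψ|) < ρ₀ / r := by
        rw [← Real.exp_log (by positivity : 0 < ρ₀ / r)]
        apply Real.exp_lt_exp.2
        have := neg_abs_le (Real.log (ρ₀ / r))
        linarith
      calc s ≤ r * Real.exp (-|ψ|) := h1
        _ < r * (ρ₀ / r) := mul_lt_mul_of_pos_left h2 hr
        _ = ρ₀ := by field_simp
    -- the majorant integral is `‖k (s, 0)‖`
    have hks : ∫ z : ℝ × ℝ, Real.exp (-(s * z.1)) ∂μ = ‖k (mk2 s 0)‖ := by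
      rw [← norm_trace_zero_eq μ s]
      exact congrArg _ ((hLF s hs_pos).2 0).symm
    rw [hks]
    have hy0 : mk2 s 0 ∈ ({0}ᶜ : Set E2) := mk2_ne_zero hs_pos.ne'
    have hnorm : ‖mk2 s 0‖ = s := by rw [norm_mk2_zero, abs_of_pos hs_pos]
    have hb := hbud hy0 (by rw [dist_zero_right, hnorm]; exact hs_upper)
    rw [Real.dist_eq, sub_zero, hnorm, abs_mul, abs_pow, abs_of_pos hs_pos, abs_norm] at hb
    have hk1 : ‖k (mk2 s 0)‖ ≤ δ * (r / 2) ^ 6 / s ^ 6 := by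
      rw [le_div_iff₀ (by positivity)]
      nlinarith [pow_pos hs_pos 6, norm_nonneg (k (mk2 s 0))]
    refine hk1.trans ?_
    rw [div_le_iff₀ (by positivity)]
    have h3 : (r / 2) ^ 6 ≤ (Real.exp |ψ| * s) ^ 6 := by
      refine pow_le_pow_left₀ (by positivity) ?_ 6
      have : r / 2 * Real.exp (-|ψ|) * Real.exp |ψ| ≤ s * Real.exp |ψ| :=
        mul_le_mul_of_nonneg_right hs_lower (Real.exp_pos _).le
      rw [mul_assoc, ← Real.exp_add, neg_add_cancel, Real.exp_zero, mul_one] at this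
      linarith
    calc δ * (r / 2) ^ 6 ≤ δ * (Real.exp |ψ| * s) ^ 6 := mul_le_mul_of_nonneg_left h3 hδ.le
      _ = δ * Real.exp (6 * |ψ|) * s ^ 6 := by
          rw [mul_pow, ← Real.exp_nat_mul]; push_cast; ring
  exact ⟨G, hG_diff, hG_real, hG_per, hG_growth⟩

end Summit.QuantumFields.YangMills.Theorems.F4SubCurvatureDoorHermitianAngular

end
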